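/-
COR-CM (cell pub-hodgecm2, stage 2 of the Hodge ladder) — count-neutral kernel combinatorics (seat prover-pub-hodgecm2-b23-g51-0, binder
prover b23, gen 51; lane SYLOW TRANSFER, claim HOME/INBOX.md l.23329).  Theorems only, in seat b09's intrinsic model (`CMF G c`, `gfaceSet`,
`pairSet`, `translates`, `hodgeSpan`, `Block`, `fibreTwo` — consumed BY NAME, nothing restated) plus Mathlib's sign of a permutation and
Sylow subgroups; no definition, no certificate, no `decide`, no named fact, no geometry, no `sorry`.
`Interfaces.lean` (C1), every E term, B01 and `Transposition/*` are untouched.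
HONEST FRAMING: `HC_CM` is NOT proved, here or anywhere in the tree; nothing here is a period or a headline.
-/
import Summits.HodgeConjecture.CorCM.Census.ComplementFacesOddHalf
import Summits.HodgeConjecture.CorCM.Census.TypeStabiliserSylow

/-!
# Sylow transfer, I: the coset sign — a central involution is complemented in `G` iff it is complemented in a Sylow `2`-subgroup

SETTING of `Census/CoinvariantFibre.lean`: `G` finite, `c` a central involution.  A COMPLEMENT of `c` is a subgroup `A` with
`x ∈ A ↔ c·x ∉ A` (`G = A ⊔ cA`), equivalently (seat b09, `Coinvariant.cpl_of_index_two` / `index_eq_two_of_cpl`) a subgroup of index two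
missing `c`; for a Galois CM field it is an imaginary quadratic subfield (`CorCM/FaceComplementImaginaryQuadratic.lean`).  Gen 40's
COMPLEMENT LAW (`ComplementFaces.isLeast_card_gfaces_generate_fibreTwo_of_cpl`) says `μ(G, c) = φ₂(G, c) = β − 1 − δ` whenever a complement
exists, and gen 40 F8 (`ComplementFaces.exists_cpl_of_odd_half`) produced one for `|G|/2` odd from the sign of the regular representation.

THIS FILE localises the existence of a complement at the prime `2`:
* §1 **THE COSET SIGN** (`sign_toPermHom_quotient_eq_neg_one`): for ANY subgroup `K ∌ c` the central involution `c` acts on `G ⧸ K` without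
  fixed points (`c·gK = gK ⟺ g⁻¹cg = c ∈ K`), so as a permutation of `G ⧸ K` it is a product of `[G:K]/2` disjoint transpositions and its
  sign is `(−1)^{[G:K]/2}`; for **`[G:K] ≡ 2 (mod 4)`** this is `−1`, and the kernel of `sign ∘ (G → Perm(G ⧸ K))` is a subgroup of index
  two missing `c` (**`exists_index_two_of_index_mod_four`**, **`exists_cpl_of_index_mod_four`**).  F8 is the case `K = ⊥`.
* §2 **SYLOW FORM** (**`exists_index_two_iff_sylow`**): `c` lies outside some subgroup of index two of `G` iff it lies outside some
  subgroup `B ≤ P` of index two IN a Sylow `2`-subgroup `P` (then `[G:B] = 2·[G:P]`, `[G:P]` odd) — «a central involution is complemented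
  iff it is complemented in a Sylow `2`-subgroup», i.e. iff `c ∉ Φ(P)`; complement currency **`exists_cpl_iff_sylow`**.  In particular a
  second involution `x ≠ c` with `[G:⟨x⟩] ≡ 2 (mod 4)`, i.e. `|G| ≡ 4 (mod 8)`, complements `c` (**`exists_cpl_of_involution`**).
* §3 **THE LAWS** (gen 40 BY NAME): **`isLeast_card_gfaces_generate_fibreTwo_of_index_mod_four`**, **`…_of_sylow`**, **`…_of_involution`** —
  `μ(G, c) = φ₂(G, c)` EXACTLY, and in block currency `β − 1 − δ` (`…_card_block`), for every central involution outside a subgroup of index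
  `≡ 2 (mod 4)`, outside an index-two subgroup of a Sylow `2`-subgroup, or accompanied by a second involution in a group of order `≡ 4 (mod 8)`.
All [folklore] bookkeeping over [Pohlmann1968, Thm 1] in the reading of [Milne1999, Prop. 2.1].

## References
* [Pohlmann1968] H. Pohlmann, Algebraic cycles on abelian varieties of complex multiplication type, Ann. of Math. 88 (1968), Thm 1.
* [Milne1999] J. S. Milne, Lefschetz motives and the Tate conjecture, Compositio Math. 117 (1999), Prop. 2.1, p. 54.
-/

namespace Summit.HodgeConjecture.CorCM.Census.SylowTransfer

open Finset
open Summit.HodgeConjecture.CorCM.Prior.AllgGroup.RfwfAllgGroup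
open Summit.HodgeConjecture.CorCM.Census.BlockParity
open Summit.HodgeConjecture.CorCM.Census.Coinvariant
open Summit.HodgeConjecture.CorCM.Census.ComplementFaces

noncomputable section

variable {G : Type*} [Group G] [Fintype G] [DecidableEq G] (c : G)

/-! ## §1 The coset sign -/

omit [Fintype G] [DecidableEq G] in
/-- The permutation of `G ⧸ K` induced by an involution has square `1`. [folklore] -/
theorem toPermHom_quotient_sq (K : Subgroup G) (hc2 : c * c = 1) : (MulAction.toPermHom G (G ⧸ K) c) ^ 2 = 1 := by
  rw [← map_pow, pow_two, hc2, map_one]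

omit [Fintype G] [DecidableEq G] in
/-- **A central element outside `K` moves every coset of `K`**: `c·gK = gK ⟺ g⁻¹cg ∈ K ⟺ c ∈ K`. [folklore] -/
theorem smul_quotient_ne (K : Subgroup G) (hcen : ∀ x : G, x * c = c * x) (hcK : c ∉ K) (q : G ⧸ K) : c • q ≠ q := by
  induction q using QuotientGroup.induction_on with
  | H g =>
    rw [MulAction.Quotient.smul_coe, smul_eq_mul, Ne, QuotientGroup.eq]
    have h1 : c⁻¹ * g = g * c⁻¹ := by rw [eq_mul_inv_iff_mul_eq, mul_assoc, hcen, inv_mul_cancel_left]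
    rwa [mul_inv_rev, mul_assoc, h1, inv_mul_cancel_left, inv_mem_iff]

omit [Fintype G] [DecidableEq G] in
/-- For central `c ∉ K` the permutation of `G ⧸ K` induced by `c` has no fixed points. [folklore] -/
theorem card_fixedPoints_toPermHom_quotient (K : Subgroup G) [Fintype (G ⧸ K)] [DecidableEq (G ⧸ K)]
    (hcen : ∀ x : G, x * c = c * x) (hcK : c ∉ K) :
    Fintype.card (Function.fixedPoints (MulAction.toPermHom G (G ⧸ K) c)) = 0 := by
  rw [Fintype.card_eq_zero_iff]
  exact ⟨fun ⟨q, hq⟩ => smul_quotient_ne c K hcen hcK q hq⟩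

omit [Fintype G] [DecidableEq G] in
/-- **THE COSET SIGN**: for central `c` with `c² = 1` outside a subgroup `K` of index `≡ 2 (mod 4)`, the sign of `c` acting on `G ⧸ K` is `−1`
(a product of `[G:K]/2` disjoint transpositions). [folklore] -/
theorem sign_toPermHom_quotient_eq_neg_one (K : Subgroup G) [Fintype (G ⧸ K)] [DecidableEq (G ⧸ K)] (hc2 : c * c = 1)
    (hcen : ∀ x : G, x * c = c * x) (hcK : c ∉ K) (hK : K.index % 4 = 2) :
    Equiv.Perm.sign (MulAction.toPermHom G (G ⧸ K) c) = -1 := by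
  have h := Equiv.Perm.sign_of_pow_two_eq_one (toPermHom_quotient_sq c K hc2)
  rw [card_fixedPoints_toPermHom_quotient c K hcen hcK, Nat.sub_zero] at h
  rw [h]
  have hidx : Fintype.card (G ⧸ K) = K.index := by rw [Subgroup.index, Nat.card_eq_fintype_card]
  have hodd : Odd (Fintype.card (G ⧸ K) / 2) := by
    rw [hidx, Nat.odd_iff]
    omega
  exact hodd.neg_one_pow

omit [DecidableEq G] in
/-- **A central involution outside a subgroup of index `≡ 2 (mod 4)` lies outside a subgroup of index two** (the kernel of the coset sign).
[folklore] -/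
theorem exists_index_two_of_index_mod_four (K : Subgroup G) (hc2 : c * c = 1) (hcen : ∀ x : G, x * c = c * x) (hcK : c ∉ K)
    (hK : K.index % 4 = 2) : ∃ A : Subgroup G, A.index = 2 ∧ c ∉ A := by
  classical
  set φ : G →* ℤˣ := Equiv.Perm.sign.comp (MulAction.toPermHom G (G ⧸ K)) with hφ
  have hφc : φ c = -1 := by rw [hφ, MonoidHom.comp_apply, sign_toPermHom_quotient_eq_neg_one c K hc2 hcen hcK hK]
  have hsurj : Function.Surjective φ := by
    intro u
    rcases Int.units_eq_one_or u with rfl | rfl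
    · exact ⟨1, map_one φ⟩
    · exact ⟨c, hφc⟩
  have hidx : φ.ker.index = 2 := by
    rw [Subgroup.index_ker, MonoidHom.range_eq_top.mpr hsurj, Subgroup.card_top, Nat.card_eq_fintype_card, Fintype.card_units_int]
  have hcK' : c ∉ φ.ker := by
    rw [MonoidHom.mem_ker, hφc]
    decide
  exact ⟨φ.ker, hidx, hcK'⟩

omit [DecidableEq G] in
/-- **A central involution outside a subgroup of index `≡ 2 (mod 4)` is complemented.** [folklore] -/
theorem exists_cpl_of_index_mod_four (K : Subgroup G) (hc2 : c * c = 1) (hcen : ∀ x : G, x * c = c * x) (hcK : c ∉ K)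
    (hK : K.index % 4 = 2) : ∃ A : Subgroup G, ∀ x : G, x ∈ A ↔ c * x ∉ A := by
  obtain ⟨A, h2, hcA⟩ := exists_index_two_of_index_mod_four c K hc2 hcen hcK hK
  exact ⟨A, cpl_of_index_two c h2 hcA⟩

/-! ## §2 Sylow form: complemented in `G` iff complemented in a Sylow `2`-subgroup -/

omit [DecidableEq G] in
/-- The index of a Sylow `2`-subgroup is odd. [folklore] -/
theorem odd_index_sylow (P : Sylow 2 G) : Odd (P : Subgroup G).index := by
  haveI : Fact (Nat.Prime 2) := ⟨Nat.prime_two⟩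
  exact Nat.odd_iff.mpr (Nat.two_dvd_ne_zero.mp (P.not_dvd_index))

omit [DecidableEq G] in
/-- A subgroup of index two inside a Sylow `2`-subgroup has index `≡ 2 (mod 4)` in `G`. [folklore] -/
theorem index_mod_four_of_relIndex_sylow (P : Sylow 2 G) {B : Subgroup G} (hBP : B ≤ P) (hB : B.relIndex P = 2) :
    B.index % 4 = 2 := by
  have h := Subgroup.relIndex_mul_index hBP
  rw [hB] at h
  obtain ⟨m, hm⟩ := odd_index_sylow P
  omega

omit [DecidableEq G] in
/-- **SYLOW FORM, index currency**: a central involution lies outside some subgroup of index two of `G` iff it lies outside some subgroup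
of index two of a Sylow `2`-subgroup `P` (i.e. `c ∉ Φ(P)`). [folklore] -/
theorem exists_index_two_iff_sylow (P : Sylow 2 G) (hc2 : c * c = 1) (hcen : ∀ x : G, x * c = c * x) :
    (∃ A : Subgroup G, A.index = 2 ∧ c ∉ A) ↔ ∃ B : Subgroup G, B ≤ P ∧ B.relIndex P = 2 ∧ c ∉ B := by
  constructor
  · rintro ⟨A, h2, hcA⟩
    haveI : A.Normal := Subgroup.normal_of_index_eq_two h2
    have hcP : c ∈ (P : Subgroup G) := TypeStabiliser.mem_sylow_of_central c hc2 hcen P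
    refine ⟨A ⊓ P, inf_le_right, ?_, fun h => hcA (Subgroup.mem_inf.mp h).1⟩
    rw [Subgroup.inf_relIndex_right]
    have hdvd : A.relIndex P ∣ 2 := by
      have h := Subgroup.relIndex_dvd_index_of_normal A (P : Subgroup G)
      rwa [h2] at h
    have hne : A.relIndex P ≠ 1 := fun h1 => hcA (Subgroup.relIndex_eq_one.mp h1 hcP)
    have hle := Nat.le_of_dvd two_pos hdvd
    interval_cases hr : A.relIndex (P : Subgroup G)
    · exact absurd hdvd (by decide)
    · exact absurd rfl hne
    · rfl
  · rintro ⟨B, hBP, hB, hcB⟩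
    exact exists_index_two_of_index_mod_four c B hc2 hcen hcB (index_mod_four_of_relIndex_sylow P hBP hB)

omit [DecidableEq G] in
/-- **SYLOW FORM, complement currency**: a central involution is complemented in `G` iff it is complemented inside a Sylow `2`-subgroup `P`
(`B ≤ P` with `x ∈ B ↔ c·x ∉ B` for `x ∈ P`). [folklore] -/
theorem exists_cpl_iff_sylow (P : Sylow 2 G) (hc2 : c * c = 1) (hcen : ∀ x : G, x * c = c * x) :
    (∃ A : Subgroup G, ∀ x : G, x ∈ A ↔ c * x ∉ A) ↔
      ∃ B : Subgroup G, B ≤ P ∧ ∀ x ∈ (P : Subgroup G), x ∈ B ↔ c * x ∉ B := by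
  have hcP : c ∈ (P : Subgroup G) := TypeStabiliser.mem_sylow_of_central c hc2 hcen P
  constructor
  · rintro ⟨A, hA⟩
    refine ⟨A ⊓ P, inf_le_right, fun x hx => ?_⟩
    rw [Subgroup.mem_inf, Subgroup.mem_inf]
    have := hA x
    have hcx : c * x ∈ (P : Subgroup G) := mul_mem hcP hx
    tauto
  · rintro ⟨B, hBP, hB⟩
    -- `B` has index two in `P` and misses `c`
    have hcB : c ∉ B := fun h => (hB c hcP).mp h (by rw [hc2]; exact B.one_mem)
    have hB' : ∀ x : (P : Subgroup G), x ∈ B.subgroupOf P ↔ (⟨c, hcP⟩ : (P : Subgroup G)) * x ∉ B.subgroupOf P := fun x => by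
      rw [Subgroup.mem_subgroupOf, Subgroup.mem_subgroupOf]
      exact hB x x.2
    have hcenP : ∀ x : (P : Subgroup G), x * ⟨c, hcP⟩ = ⟨c, hcP⟩ * x := fun x => Subtype.ext (hcen x)
    have h2 : (B.subgroupOf P).index = 2 := index_eq_two_of_cpl (⟨c, hcP⟩ : (P : Subgroup G)) hcenP hB'
    exact exists_cpl_of_index_mod_four c B hc2 hcen hcB (index_mod_four_of_relIndex_sylow P hBP h2)

/-- **A second involution in a group of order `≡ 4 (mod 8)` complements `c`**: `K = ⟨x⟩` has index `|G|/2 ≡ 2 (mod 4)` and misses `c`.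
[folklore] -/
theorem exists_cpl_of_involution (hc2 : c * c = 1) (hc1 : c ≠ 1) (hcen : ∀ x : G, x * c = c * x) {x : G} (hx2 : x * x = 1)
    (hx1 : x ≠ 1) (hxc : x ≠ c) (hG : Fintype.card G % 8 = 4) : ∃ A : Subgroup G, ∀ y : G, y ∈ A ↔ c * y ∉ A := by
  have hord : orderOf x = 2 := orderOf_eq_prime (by rw [pow_two, hx2]) hx1
  have hcard : Nat.card (Subgroup.zpowers x) = 2 := by rw [Nat.card_zpowers, hord]
  have hidx : (Subgroup.zpowers x).index % 4 = 2 := by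
    have h := (Subgroup.zpowers x).card_mul_index
    rw [hcard, Nat.card_eq_fintype_card] at h
    omega
  refine exists_cpl_of_index_mod_four c (Subgroup.zpowers x) hc2 hcen (fun h => ?_) hidx
  rw [mem_zpowers_iff_mem_range_orderOf, hord, Finset.mem_image] at h
  obtain ⟨i, hi, hix⟩ := h
  have hi2 : i < 2 := Finset.mem_range.mp hi
  interval_cases i
  · rw [pow_zero] at hix
    exact hc1 hix.symm
  · rw [pow_one] at hix
    exact hxc hix

/-! ## §3 The laws: `μ = φ₂` -/

/-- **`μ(G, c) = φ₂(G, c)` for every central involution `c ≠ 1` outside a subgroup of index `≡ 2 (mod 4)`.** [folklore] -/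
theorem isLeast_card_gfaces_generate_fibreTwo_of_index_mod_four (K : Subgroup G) (hcK : c ∉ K) (hK : K.index % 4 = 2)
    (hc2 : c * c = 1) (hc1 : c ≠ 1) (hcen : ∀ x : G, x * c = c * x) :
    IsLeast {m : ℕ | ∃ S : Finset (CMF G c →₀ ℤ), (↑S ⊆ gfaceSet G c hc2) ∧ S.card = m ∧
      hodgeSpan c hc2 ≤ Submodule.span ℤ (pairSet c) ⊔ Submodule.span ℤ (translates c S)} (fibreTwo c hc2) := by
  obtain ⟨A, hA⟩ := exists_cpl_of_index_mod_four c K hc2 hcen hcK hK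
  exact isLeast_card_gfaces_generate_fibreTwo_of_cpl c hA hc2 hc1 hcen

/-- Block currency: `μ(G, c) = β(G, c) − 1 − δ` for every central involution outside a subgroup of index `≡ 2 (mod 4)`. [folklore] -/
theorem isLeast_card_gfaces_generate_of_index_mod_four (K : Subgroup G) (hcK : c ∉ K) (hK : K.index % 4 = 2)
    (hc2 : c * c = 1) (hc1 : c ≠ 1) (hcen : ∀ x : G, x * c = c * x) (T₀ : CMF G c) :
    IsLeast {m : ℕ | ∃ S : Finset (CMF G c →₀ ℤ), (↑S ⊆ gfaceSet G c hc2) ∧ S.card = m ∧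
      hodgeSpan c hc2 ≤ Submodule.span ℤ (pairSet c) ⊔ Submodule.span ℤ (translates c S)}
      (Fintype.card (Block c) - 1 - wdelta c T₀) := by
  obtain ⟨A, hA⟩ := exists_cpl_of_index_mod_four c K hc2 hcen hcK hK
  exact isLeast_card_gfaces_generate_of_cpl c hA hc2 hc1 hcen T₀

/-- **`μ(G, c) = φ₂(G, c)` for every central involution `c ≠ 1` outside an index-two subgroup of a Sylow `2`-subgroup** (`c ∉ Φ(P)`).
[folklore] -/
theorem isLeast_card_gfaces_generate_fibreTwo_of_sylow (P : Sylow 2 G) {B : Subgroup G} (hBP : B ≤ P) (hB : B.relIndex P = 2)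
    (hcB : c ∉ B) (hc2 : c * c = 1) (hc1 : c ≠ 1) (hcen : ∀ x : G, x * c = c * x) :
    IsLeast {m : ℕ | ∃ S : Finset (CMF G c →₀ ℤ), (↑S ⊆ gfaceSet G c hc2) ∧ S.card = m ∧
      hodgeSpan c hc2 ≤ Submodule.span ℤ (pairSet c) ⊔ Submodule.span ℤ (translates c S)} (fibreTwo c hc2) :=
  isLeast_card_gfaces_generate_fibreTwo_of_index_mod_four c B hcB (index_mod_four_of_relIndex_sylow P hBP hB) hc2 hc1 hcen

/-- Block currency: `μ(G, c) = β(G, c) − 1 − δ` for every central involution outside an index-two subgroup of a Sylow `2`-subgroup.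
[folklore] -/
theorem isLeast_card_gfaces_generate_of_sylow (P : Sylow 2 G) {B : Subgroup G} (hBP : B ≤ P) (hB : B.relIndex P = 2)
    (hcB : c ∉ B) (hc2 : c * c = 1) (hc1 : c ≠ 1) (hcen : ∀ x : G, x * c = c * x) (T₀ : CMF G c) :
    IsLeast {m : ℕ | ∃ S : Finset (CMF G c →₀ ℤ), (↑S ⊆ gfaceSet G c hc2) ∧ S.card = m ∧
      hodgeSpan c hc2 ≤ Submodule.span ℤ (pairSet c) ⊔ Submodule.span ℤ (translates c S)}
      (Fintype.card (Block c) - 1 - wdelta c T₀) :=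
  isLeast_card_gfaces_generate_of_index_mod_four c B hcB (index_mod_four_of_relIndex_sylow P hBP hB) hc2 hc1 hcen T₀

/-- **`μ(G, c) = φ₂(G, c)` for every central involution `c ≠ 1` of a group of order `≡ 4 (mod 8)` possessing a second involution.**
[folklore] -/
theorem isLeast_card_gfaces_generate_fibreTwo_of_involution (hc2 : c * c = 1) (hc1 : c ≠ 1) (hcen : ∀ x : G, x * c = c * x)
    {x : G} (hx2 : x * x = 1) (hx1 : x ≠ 1) (hxc : x ≠ c) (hG : Fintype.card G % 8 = 4) :
    IsLeast {m : ℕ | ∃ S : Finset (CMF G c →₀ ℤ), (↑S ⊆ gfaceSet G c hc2) ∧ S.card = m ∧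
      hodgeSpan c hc2 ≤ Submodule.span ℤ (pairSet c) ⊔ Submodule.span ℤ (translates c S)} (fibreTwo c hc2) := by
  obtain ⟨A, hA⟩ := exists_cpl_of_involution c hc2 hc1 hcen hx2 hx1 hxc hG
  exact isLeast_card_gfaces_generate_fibreTwo_of_cpl c hA hc2 hc1 hcen

end

end Summit.HodgeConjecture.CorCM.Census.SylowTransfer
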